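import Literature.Geometry.ComplexAnalytic.RelativeExponentialUniformisation
import Literature.NumberTheory.Transcendental.AnalytificationMorphismsProofs
import Literature.AlgebraicGeometry.Motives.AlgPointsSeparate
import Literature.AlgebraicGeometry.Resolution.SmoothStalksRegular
import Literature.AlgebraicGeometry.AbelianSchemes.AbelianSchemeOverHomNoetherianAnyBase
import Literature.AlgebraicGeometry.AbelianSchemes.AbelianSchemeFibreHom
import HarnessLib

/-!
# A holomorphic self-map of the analytified total space of an abelian scheme over `S`, over `S` and fixing the zero
# section, is an algebraic endomorphism of the abelian scheme (E6-an: GAGA + rigidity)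

Topic `Literature/AlgebraicGeometry/AbelianSchemes`, namespace `Literature.AlgebraicGeometry.AbelianSchemes.AbelianSchemeOver`.
THEOREMS ONLY (no definition, no named fact, no instance, no notation, no `sorry`).  Cell hodgecm-mathlib (D-0151), P6 door
(E), organ **E6-an** (E6 owner A-p06 (g32) deal 2026-09-01T22:40:05Z): the GAGA step of the E6 closer՚s socket σ1 — the
holomorphic endomorphism of `P.A^an` produced over the curve by ★ U6-b (`MarkedFamilyHomCriterion`) from the lattice reading is
an ENDOMORPHISM OF THE ABELIAN SCHEME `P.A → X`.  HC_CM is proved only modulo the printed citations until rung 0 closes; this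
file is generic and changes no count.

MATHEMATICS ([SerreGAGA1956] §3 Prop. 15 ∕ [Arapura2012] Cor. 15.4.6 «a holomorphic map between smooth projective varieties is
algebraic» = ★ `Transcendental.arapura2012_cor_15_4_6_holds`; [MumfordAV1970] §4 «points are dense» = ★
`Motives.SchemeOver.hom_ext_of_forall_algPoints`; [MumfordFogartyKirwan1994] Ch. 6 §1 Cor. 6.4 «a morphism of abelian schemes
preserving the zero sections is a homomorphism» = ★ `isMonHom_of_one_comp_of_isLocallyNoetherian_base`).  Let `S` be a
`ℂ`-scheme locally of finite type, separated and smooth, `A → S` an abelian scheme whose total space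
`T := Over.mk (A.X.hom ≫ S.hom)` (★ `ComplexAnalytic.totalOver S A`) is a smooth projective `ℂ`-variety of dimension `n`
(★ `isSmoothProjective_total`), `φA : MA → T(ℂ)` an analytification with holomorphic atlas, and `y : MA → MA` HOLOMORPHIC with
(i) `y` OVER `S` on points (`(φA (y m)) ≫ π = (φA m) ≫ π`) and (ii) `y m = m` whenever `φA m` lies on the zero section.
* §1 `exists_hom_of_mdifferentiable_over` — GAGA: `y` is induced by a `ℂ`-morphism `G : T ⟶ T`, and `G` lies OVER `S`
  (`G.left ≫ A.X.hom = A.X.hom`): both `G ≫ π` and `π` agree on all `ℂ`-points (`φA` is onto), `T` is reduced (smooth over `ℂ`, ★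
  `Resolution.isReduced_of_smooth`) and `S` separated.
* §2 HEAD **`exists_isMonHom_of_mdifferentiable`** — the `S`-morphism `Y := Over.homMk G.left _ : A.X ⟶ A.X` preserves the zero
  section (`η ≫ Y = η`, again by points: `y` fixes the analytic zero section) hence `IsMonHom Y` (rigidity over the locally
  noetherian `S`), and `(φA (y m)).left = (φA m).left ≫ Y.left` for every `m`.
* §3 `fibrePointToLeft_map_fibreHom_eq` — fibre reading: on the fibre `A_s`, `Y_s = fibreHom Y s` sends the point under `m` to the
  point under `y m` (★ `fibrePointToLeft_map_fibreHom`).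

## References
* [SerreGAGA1956] J.-P. Serre, *Géométrie algébrique et géométrie analytique*, Ann. Inst. Fourier 6 (1956), §3 Prop. 15.
* [Arapura2012] D. Arapura, *Algebraic Geometry over the Complex Numbers* (2012), Cor. 15.4.6.
* [MumfordAV1970] D. Mumford, *Abelian Varieties* (1970), §4 (density of points).
* [MumfordFogartyKirwan1994] D. Mumford, J. Fogarty, F. Kirwan, *Geometric Invariant Theory*, 3rd ed. (1994), Ch. 6 §1 Cor. 6.4
  (p. 117).
-/

set_option autoImplicit false

noncomputable section

open scoped Manifold ContDiff
open CategoryTheory CategoryTheory.Limits AlgebraicGeometry MonObj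
open Literature.NumberTheory.Transcendental (IsAnalytification arapura2012_cor_15_4_6_holds)
open Literature.AlgebraicGeometry.Motives (SchemeOver AlgPoints ComplexPoints IsSmoothProjective)
open Literature.Geometry.ComplexAnalytic (totalOver projOver)

namespace Literature.AlgebraicGeometry.AbelianSchemes.AbelianSchemeOver

variable {S : SchemeOver ℂ} [LocallyOfFiniteType S.hom] [IsSeparated S.hom] (A : AbelianSchemeOver S.left) {n : ℕ}
  {E : Type} [NormedAddCommGroup E] [NormedSpace ℂ E] [FiniteDimensional ℂ E]
  {MA : Type} [TopologicalSpace MA] [ChartedSpace E MA] [IsManifold 𝓘(ℂ, E) ω MA]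
  {φA : MA → ComplexPoints (totalOver S A)}

/-! ### §1 GAGA: the holomorphic self-map is algebraic, and lies over `S` -/

omit [LocallyOfFiniteType S.hom] in
/-- **GAGA over the base**: a holomorphic self-map `y` of the analytified total space of `A → S` (smooth projective total space),
lying over `S` on points, is induced by a `ℂ`-morphism `G` of the total space with `G.left ≫ A.X.hom = A.X.hom`.
[cite: SerreGAGA1956, §3 Prop. 15] [cite: Arapura2012, Cor. 15.4.6] [cite: MumfordAV1970, §4] -/
theorem exists_hom_of_mdifferentiable_over (hT : IsSmoothProjective n (totalOver S A))
    (hφA : IsAnalytification E (totalOver S A) n φA) {y : MA → MA} (hy : MDifferentiable 𝓘(ℂ, E) 𝓘(ℂ, E) y)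
    (hover : ∀ m, (φA (y m)).left ≫ A.X.hom = (φA m).left ≫ A.X.hom) :
    ∃ G : totalOver S A ⟶ totalOver S A, G.left ≫ A.X.hom = A.X.hom ∧ ∀ m, φA (y m) = AlgPoints.map G (φA m) := by
  obtain ⟨G, hG⟩ := arapura2012_cor_15_4_6_holds (totalOver S A) (totalOver S A) hT hT E MA φA hφA E MA φA hφA y hy
  refine ⟨G, ?_, hG⟩
  -- `G ≫ π = π` on `ℂ`-points, hence as morphisms (`T` reduced, `S` separated)
  haveI := hT.smoothOfRelativeDimension
  haveI : Smooth (totalOver S A).hom := SmoothOfRelativeDimension.smooth n _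
  haveI : IsReduced (totalOver S A).left := Literature.AlgebraicGeometry.Resolution.isReduced_of_smooth (totalOver S A).hom
  haveI : LocallyOfFiniteType (totalOver S A).hom := inferInstance
  have hπ : G ≫ projOver S A = projOver S A := by
    refine SchemeOver.hom_ext_of_forall_algPoints ℂ fun P ↦ ?_
    obtain ⟨m, rfl⟩ := hφA.isHomeomorph.surjective P
    have h1 : φA m ≫ G = φA (y m) := (hG m).symm
    rw [← Category.assoc, h1]
    ext : 1
    simp only [Over.comp_left, Over.homMk_left]
    exact hover m
  have := congrArg CommaMorphism.left hπ
  simpa only [Over.comp_left, Over.homMk_left] using this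

/-! ### §2 HEAD: the induced `S`-endomorphism is a homomorphism of abelian schemes -/

/-- **(E6-an) A HOLOMORPHIC SELF-MAP OF `A^an` OVER `S` FIXING THE ZERO SECTION IS AN ENDOMORPHISM OF THE ABELIAN SCHEME.**
For `A → S` with smooth projective total space, an analytification `φA : MA → A(ℂ)` (holomorphic atlas) and `y : MA → MA`
holomorphic, over `S` on points, with `y m = m` whenever `φA m` lies on the zero section: there is an `S`-endomorphism
`Y : A.X ⟶ A.X` which is a HOMOMORPHISM of `S`-group schemes and induces `y`: `(φA (y m)).left = (φA m).left ≫ Y.left`.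
(GAGA ★ `arapura2012_cor_15_4_6_holds`; points separate morphisms ★ `SchemeOver.hom_ext_of_forall_algPoints`; rigidity ★
`isMonHom_of_one_comp_of_isLocallyNoetherian_base`.) [cite: SerreGAGA1956, §3 Prop. 15]
[cite: MumfordFogartyKirwan1994, Ch. 6 §1 Corollary 6.4 (p. 117)] [cite: MumfordAV1970, §4] -/
theorem exists_isMonHom_of_mdifferentiable [IsReduced S.left] (hT : IsSmoothProjective n (totalOver S A))
    (hφA : IsAnalytification E (totalOver S A) n φA) {y : MA → MA} (hy : MDifferentiable 𝓘(ℂ, E) 𝓘(ℂ, E) y)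
    (hover : ∀ m, (φA (y m)).left ≫ A.X.hom = (φA m).left ≫ A.X.hom)
    (hzero : ∀ m, (∃ s : Spec (.of ℂ) ⟶ S.left, (φA m).left = s ≫ A.unitSection) → y m = m) :
    ∃ Y : A.X ⟶ A.X, IsMonHom Y ∧ ∀ m, (φA (y m)).left = (φA m).left ≫ Y.left := by
  obtain ⟨G, hGS, hG⟩ := A.exists_hom_of_mdifferentiable_over hT hφA hy hover
  let Y : A.X ⟶ A.X := Over.homMk G.left hGS
  have hYm : ∀ m, (φA (y m)).left = (φA m).left ≫ Y.left := fun m ↦ by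
    have h1 : φA (y m) = φA m ≫ G := hG m
    rw [h1]; rfl
  refine ⟨Y, ?_, hYm⟩
  -- the zero section, as a `ℂ`-morphism `u : S ⟶ T`
  let u : S ⟶ totalOver S A := Over.homMk A.unitSection (by
    change A.unitSection ≫ A.X.hom ≫ S.hom = S.hom
    rw [← Category.assoc, A.unitSection_comp_hom, Category.id_comp])
  -- `u ≫ G = u`: check on `ℂ`-points of the reduced, finite-type `S` (target `T` separated over `ℂ`)
  haveI := A.isProper
  haveI : IsSeparated (totalOver S A).hom := by
    change IsSeparated (A.X.hom ≫ S.hom); infer_instance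
  have hu : u ≫ G = u := by
    refine SchemeOver.hom_ext_of_forall_algPoints ℂ fun P ↦ ?_
    obtain ⟨m, hm⟩ := hφA.isHomeomorph.surjective (P ≫ u)
    have hfix : y m = m := hzero m ⟨P.left, by rw [hm]; rfl⟩
    have h1 : φA m ≫ G = φA (y m) := (hG m).symm
    rw [← Category.assoc, ← hm, h1, hfix]
  -- hence `η ≫ Y = η` in `Over S.left`, and rigidity gives `IsMonHom Y`
  haveI : IsLocallyNoetherian S.left := LocallyOfFiniteType.isLocallyNoetherian S.hom
  have hu' : A.unitSection ≫ G.left = A.unitSection := congrArg CommaMorphism.left hu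
  have hη : η[A.X] ≫ Y = η[A.X] := by
    ext : 1
    exact hu'
  exact isMonHom_of_one_comp_of_isLocallyNoetherian_base Y hη

/-! ### §3 Fibre reading -/

omit [LocallyOfFiniteType S.hom] [IsSeparated S.hom] [TopologicalSpace MA] [ChartedSpace E MA] [IsManifold 𝓘(ℂ, E) ω MA] in
/-- **Fibre reading of the induced endomorphism**: if `P` is the point of the fibre `A_s` under `m` (through ★ `fibrePointToLeft`),
then `Y_s (P) = fibreHom Y s P` is the point under `y m`. [cite: MumfordFogartyKirwan1994, Ch. 6 §2 Definition 6.3 (p. 120)] -/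
theorem fibrePointToLeft_map_fibreHom_eq {Y : A.X ⟶ A.X} [IsMonHom Y] {y : MA → MA}
    (hY : ∀ m, (φA (y m)).left = (φA m).left ≫ Y.left) (s : Spec (.of ℂ) ⟶ S.left)
    (P : (A.fibre s).toAbelianVariety.Points ℂ) {m : MA} (hP : A.fibrePointToLeft s P = (φA m).left) :
    A.fibrePointToLeft s (AlgPoints.map (fibreHom Y s).hom.hom.hom P) = (φA (y m)).left := by
  rw [fibrePointToLeft_map_fibreHom, hP]
  exact (hY m).symm

end Literature.AlgebraicGeometry.AbelianSchemes.AbelianSchemeOver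

end
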